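import Summits.AtomisticToContinuum.BoseEinsteinCondensation.Theorems.BECInfDivCoherenceGridInfDivCoherenceGridCharacterSum

/-!
# Route BECInfDivCoherence — crux `LevyNegativeMoment`, line `registered`: grid character sums

Helper file for the crux `stmt-AtomisticToContinuum-9115` (declaration
`Summit.AtomisticToContinuum.BoseEinsteinCondensation.Theses.BECInfDivCoherence.LevyNegativeMoment`)
closing the stub `stub_cosSumVanishes` of line `registered` (birth skeleton).

For a frequency `q : Fin 3 → Fin m` that is not `≡ 0 (mod m)` (some coordinate `q k ≠ 0`), the
character sum over the discrete torus `(ℤ/m)³` vanishes: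
`∑_{j : Fin 3 → Fin m} cos (2π (q·j)/m) = 0`.
This is the mechanism behind the zero grid mean of the grid Riesz kernel
`K(j) = Σ_{q≢0} cos(2π q·j/m)/m³/|k_q|` in the composition `rieszKernelBound_of` of the line.

The statement is byte-identical to the already-landed support lemma of the sister crux
`GridInfDivCoherence` (stmt-AtomisticToContinuum-9114),
`Summit.AtomisticToContinuum.BoseEinsteinCondensation.Theorems.stub_gridCharacterSum`
(orthogonality of the non-trivial characters of `(ℤ/m)³`, via `Complex.exp_ofReal_mul_I_re`,
`Complex.exp_sum`, `Fintype.prod_sum` and the one-dimensional root-of-unity sums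
`BECInfDivCoherenceGridAverage.sum_exp_two_pi_div`); this file only re-exports it under the
name registered for the present line, as an `alias` (no restatement), together with the form in
which the line consumes it: every grid kernel `j ↦ Σ_{q≢0} cos(2π q·j/m)/c/D(q)` (the grid Riesz
kernel is `c = m³`, `D(q) = |k_q|`) has grid mean zero — exchange the two finite sums
(`Finset.sum_comm`) and pull the weights out (`Finset.sum_div`). [folklore]
-/

namespace Summit.AtomisticToContinuum.BoseEinsteinCondensation.Cruxes.LevyNegativeMoment.Birth

/-- **Grid character sums vanish off the zero frequency** (stub `stub_cosSumVanishes` of the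
birth line of crux `LevyNegativeMoment`): for `q : Fin 3 → Fin m` with some `(q k : ℕ) ≠ 0`,
`∑_{j : Fin 3 → Fin m} cos (2π (∑_k q_k j_k)/m) = 0`.  Alias of the landed
`Summit.AtomisticToContinuum.BoseEinsteinCondensation.Theorems.stub_gridCharacterSum`
(crux `GridInfDivCoherence`, same route): real part of the complex character sum, which
factorises into three one-dimensional sums of `m`-th roots of unity, the `k`-th of which
vanishes. [folklore] -/
alias stub_cosSumVanishes :=
  Summit.AtomisticToContinuum.BoseEinsteinCondensation.Theorems.stub_gridCharacterSum

open scoped BigOperators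

/-- **Grid kernels built from non-trivial characters have grid mean zero** (the zero-mean
conjunct of `RieszKernelBound` in the line, for arbitrary weights): for every `m`, every scalar
`c` and every weight `D` on frequencies,
`∑_j ∑_{q ≢ 0} cos (2π (q·j)/m) / c / D q = 0` — exchange the sums and apply
`stub_cosSumVanishes` frequency by frequency (the grid Riesz kernel of crux `LevyNegativeMoment`
is the case `c = m³`, `D q = (2π/L) √(Σ_k min (q_k, m - q_k)²)`). [folklore] -/
theorem cosSum_gridKernel_mean_eq_zero (m : ℕ) (c : ℝ) (D : (Fin 3 → Fin m) → ℝ) :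
    ∑ j : Fin 3 → Fin m, (∑ q : Fin 3 → Fin m with (∃ k, (q k : ℕ) ≠ 0),
      Real.cos (2 * Real.pi * (∑ k, ((q k : ℕ) : ℝ) * ((j k : ℕ) : ℝ)) / m) / c / D q) = 0 := by
  rw [Finset.sum_comm]
  refine Finset.sum_eq_zero fun q hq => ?_
  rw [← Finset.sum_div, ← Finset.sum_div, stub_cosSumVanishes m q (Finset.mem_filter.mp hq).2,
    zero_div, zero_div]

end Summit.AtomisticToContinuum.BoseEinsteinCondensation.Cruxes.LevyNegativeMoment.Birth
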